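import Summits.QuantumFields.BalabanUV.Beta.SecondOrderMixedModel
import Summits.QuantumFields.BalabanUV.Beta.WardBorderReflection
import Summits.QuantumFields.BalabanUV.Beta.AveragingWardRootedKernels
import Summits.QuantumFields.BalabanUV.Beta.AveragingBorderWitness

/-!
# `BalabanUV.Beta.WardMixedModelNoGo` — binder row D1, (L4): **THE hR MIXED MODEL `Mmodel` VIOLATES THE hW MIXED WARD LETTER (W-M₀)**,
# in both currencies (β sub-cell, D1 formalisation swarm, unit `b2b-balaban-beta-d1-formalise-leaf-06`, gen 4; «D1-hRhW-MIXED-JOINT-MODEL» part A)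

HONEST FRAMING (cell charter, verbatim): «discharging `BetaPertH` makes Bałaban's UV stability UNCONDITIONAL — a real constructive-QFT
result; it is NOT the continuum limit and NOT the Clay problem.»  HONEST DEPENDENCY (verbatim): «continuum YM on T⁴ ⇐ BetaPertH ∧ nine spine
estimates (0/9 proved); BetaPertH ⇐ (D1) ∧ (D4) ∧ CAP+tail; G-an2-4 gates asym, D1 and NE2/3/4.»  [folklore] field-leg Kronecker algebra of the
row-D1 owner's model mixed table (`SecondOrderMixedModel.Mmodel`, K-M1 p222594), one parity remark, a discrete divergence theorem, and an1's rooted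
Ward identity `AveragingWardRootedKernels.hessKerAt_div_left` with leaf-04's `AveragingBorderWitness.linCountAt_ctr_pos` BY NAME.  No statement of
Bałaban's papers, no `[cite:]`, no `def`, no `def … : Prop`; a located NO-GO about a MODEL table [our object] — NOT about Bałaban's `mixFFAt`; instantiates
NO binder of the β-function wall (0/4: hW, hR, D1Tel, D1Rep).  NOT hW, NOT hR, NOT D1, NOT `BetaPertH`, NOT continuum, NOT Clay.

WHAT (`d + 1 = 4`, centred root `ρ_c = toSite (ctrOff 4 Lc)`, `H_{ρ′w} := hessFFAt ρ_c Lc ρ′ w`, parity-ODD by `hessFFAt_antisymm`).  The hW END of record at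
`T_W` (`WardLocusParityLevels.…_TW_su_exact₀` p221259, resp. `…_of_evenHalf_laws₀`) takes the LEVEL-0 MIXED WARD LETTER (W-M₀): ∀ `Y ρ′ w`,
`(stepScale 0 · Lc⁴)⁻¹ • Σ_{v∈box} divV (κ u ↦ M2Of 3 Lc mixFF 0 κ u ρ′ w) (Lc•Y + v) = [M1At 0 ρ′ w, D_Y] + RM₀ Y ρ′ w`, `D_Y = diagK (½ • Σ_v legInd ρ_c (Lc•Y + v))`,
`RM₀` ROW-PARITY-ODD (`trK RM₀ = −sgnK RM₀`) — resp. the even-half form `L + sgnK (trK L) = 2 • [M1At 0, D_Y]`.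
* §1 **`Mmodel_inl_inl`**: on field legs `Mmodel κ u ρ′ w x z β β′ = (cΛ·Lc⁴∕4) · H_{ρ′w} x z β β′ · ([x = u ∧ β = κ] − [z = u ∧ β′ = κ])`.
* §2 **`wardOp_Mmodel_inl_inl`**: its block Ward divergence on field legs is `(cΛ∕4) · H · (g_Y(x,β) − g_Y(z,β′))`, `g_Y(p,β) = Σ_v [p + e_β = Lc•Y + v] − Σ_v [p = Lc•Y + v]`
  (bond-gradient of the block indicator); `mixedDatum_inl_inl`: the datum is `cΛ · H · (½ Σ_v [z = ·] − ½ Σ_v [x = ·])`.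
* §3 **`mismatch_eq_zero_of_parity`** ∕ `_of_evenHalf`: (W-M₀) for `Mmodel` forces `cΛ · H_{ρ′w} x z β β′ · (E_Y(x,β) − E_Y(z,β′)) = 0`,
  `E_Y(p,β) := Σ_v [p = Lc•Y + v] + Σ_v [p + e_β = Lc•Y + v]` (number of endpoints of the fine bond in the block): the mismatch `(cΛ∕4)·H·(E − E′)` is
  parity-EVEN and an odd residual cannot absorb it.  §4 `sum_div_eq_zero_of_internal`: discrete divergence theorem on a finite site set.
* §5 **`not_key`**: §3's conclusion is FALSE for `2 ≤ Lc`, `cΛ ≠ 0`: `b ↦ H_{0,0}(b, f′)`, `f′ = (3, ρ_c)` (both endpoints in `B(0)`), would live on internal bonds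
  of `B(0)`, so its divergence summed over `B(0)` would vanish — but `hessKerAt_div_left` summed over `B(0)` gives `q¹(f′)∕2 ≠ 0` (`linCountAt_ctr_pos`).
* §6 **`not_wardMixed_Mmodel`** (∀ parity-odd `RM₀`, ¬(W-M₀)[`mixFF := Mmodel`]), **`not_wardMixedEven_Mmodel`**: the K-M2 model literal
  `JsRecWAtOf (… locStencilFM_Mmodel …)` (p222778) cannot be fed to the hW END.  Parts B∕C: the mixed consistency identity holds; a JOINT model exists.
Provenance: D1 formalisation swarm, leaf prover 06 (gen 4), 2026-08-20; agrees with the owner an2-g20's pen-and-paper CORRECTION (journal l.15944).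
-/

noncomputable section

open Finset
open scoped BigOperators
open Literature.MathematicalPhysics.QuantumFieldTheory
open Literature.MathematicalPhysics.QuantumFieldTheory.Balaban1983to89
open Literature.MathematicalPhysics.QuantumFieldTheory.Balaban1983to89.Beta
open ExpKernelCalculus (MKer comp)
open KernelWard (divV)
open AffineAveraging (Site box toSite unitVec unitVec_apply)
open AveragingContoursRooted (ctr ctrOff ctrOff_mem_box)
open AveragingHessianKernels (Bond)
open AveragingHessianKernelsRooted (hessFFAt hessFFAt_inl_inl hessFFAt_antisymm hessKerAt linKerAt linCountAt)
open OneStepResolventKernel (Fib)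
open BalabanStepW2 (M2Of wM1 wM2)
open Summit.QuantumFields.BalabanUV.Beta.TameKernelCalculus
open Summit.QuantumFields.BalabanUV.Beta.ChartConjugation (conjV)
open Summit.QuantumFields.BalabanUV.Beta.BorderedHessian (diagK ctGen ctGen_inl conjV_diagK_apply stepScale sgnF sgnK sgnK_apply)
open Summit.QuantumFields.BalabanUV.Beta.AveragingWardRootedStencils (legInd legInd_inl)
open Summit.QuantumFields.BalabanUV.Beta.SpineRooted (M1At)
open Summit.QuantumFields.BalabanUV.Beta.KernelWardLevels (stepScale_zero)
open Summit.QuantumFields.BalabanUV.Beta.SecondOrderMixedModel (Dmix Dmix_apply Mmodel)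
open Summit.QuantumFields.BalabanUV.Beta.WardBorderReflection (unitVec_eq)
open Summit.QuantumFields.BalabanUV.Beta.AveragingWardRootedKernels (hessKerAt_div_left)
open Summit.QuantumFields.BalabanUV.Beta.AveragingBorderWitness (linCountAt_ctr_pos)

namespace Summit.QuantumFields.BalabanUV.Beta.WardMixedModelNoGo

variable {Lc : ℕ} [NeZero Lc]

/-! ## §1 Field-leg calculus of the model mixed table -/

omit [NeZero Lc] in
/-- [folklore] The generator family summed over the four axes, read on a field leg: `Σ_α ĝ^α_{κu}(p, inl β) = −[p = u ∧ β = κ]`. -/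
theorem sum_ctGen_inl (κ : Fin 4) (u p : Fin 4 → ℤ) (β : Fin 4) :
    ∑ α : Fin 4, ctGen 3 α Lc κ u p (Sum.inl β) = -(if p = u ∧ β = κ then (1 : ℝ) else 0) := by
  classical
  simp only [ctGen_inl]
  by_cases h : p = u ∧ β = κ
  · rw [if_pos h, Finset.sum_eq_single κ]
    · rw [if_pos ⟨h.1, h.2, rfl⟩]
    · exact fun α _ hα => if_neg fun ⟨_, _, e⟩ => hα e.symm
    · exact fun hκ => absurd (Finset.mem_univ κ) hκ
  · rw [if_neg h, neg_zero]
    exact Finset.sum_eq_zero fun α _ => if_neg fun ⟨h1, h2, _⟩ => h ⟨h1, h2⟩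

/-- [folklore] **THE MODEL MIXED TABLE ON FIELD LEGS**: `Mmodel κ u ρ′ w x z β β′ = (cΛ·Lc⁴∕4) · H_{ρ′w} x z β β′ · ([x = u ∧ β = κ] − [z = u ∧ β′ = κ])`
(minus `Lc⁴∕4` times the commutator of `cΛ • H_{ρ′w}` with the projector onto the fine bond `(κ, u)`). -/
theorem Mmodel_inl_inl (cΛ : ℝ) (κ : Fin 4) (u : Fin 4 → ℤ) (ρ' : Fin 4) (w x z : Fin 4 → ℤ) (β β' : Fin 4) :
    Mmodel Lc cΛ κ u ρ' w x z (Sum.inl β) (Sum.inl β') =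
      cΛ * (Lc : ℝ) ^ 4 / 4 * hessFFAt (toSite (ctrOff 4 Lc)) Lc ρ' w x z (Sum.inl β) (Sum.inl β') *
        ((if x = u ∧ β = κ then (1 : ℝ) else 0) - (if z = u ∧ β' = κ then (1 : ℝ) else 0)) := by
  have hz := sum_ctGen_inl (Lc := Lc) κ u z β'
  have hx := sum_ctGen_inl (Lc := Lc) κ u x β
  rw [Fin.sum_univ_four] at hz hx
  have e : Mmodel Lc cΛ κ u ρ' w x z (Sum.inl β) (Sum.inl β') =
      -(1 / 2 : ℝ) * (Dmix Lc cΛ 0 κ u ρ' w x z (Sum.inl β) (Sum.inl β') + Dmix Lc cΛ 1 κ u ρ' w x z (Sum.inl β) (Sum.inl β') +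
        Dmix Lc cΛ 2 κ u ρ' w x z (Sum.inl β) (Sum.inl β') + Dmix Lc cΛ 3 κ u ρ' w x z (Sum.inl β) (Sum.inl β')) := by
    simp only [SecondOrderMixedModel.Mmodel, Pi.smul_apply, Pi.add_apply, smul_eq_mul]
  rw [e, Dmix_apply, Dmix_apply, Dmix_apply, Dmix_apply]
  set H := hessFFAt (toSite (ctrOff 4 Lc)) Lc ρ' w x z (Sum.inl β) (Sum.inl β')
  linear_combination (-(1 / 2 : ℝ) * cΛ * H * (-((Lc : ℝ) ^ 4 / 2))) * (hz - hx)

/-! ## §2 The block Ward divergence of `Mmodel` and the mixed datum, on field legs -/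

/-- [folklore] Summing `[P κ ∧ β = κ]` over `κ` picks `κ = β`. -/
theorem sum_ite_and_eq (P : Fin 4 → Prop) [DecidablePred P] (β : Fin 4) :
    ∑ κ : Fin 4, (if P κ ∧ β = κ then (1 : ℝ) else 0) = if P β then 1 else 0 := by
  rw [Finset.sum_eq_single β]
  · by_cases h : P β
    · rw [if_pos ⟨h, rfl⟩, if_pos h]
    · rw [if_neg (fun h' => h h'.1), if_neg h]
  · exact fun κ _ hκ => if_neg fun ⟨_, e⟩ => hκ e.symm
  · exact fun h => absurd (Finset.mem_univ β) h

omit [NeZero Lc] in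
/-- [folklore] At level `0` the mixed table carries weight `wM2 0 = 1`: `M2Of 3 Lc mixFF 0 κ u ρ w = mixFF κ u ρ w`. -/
theorem M2Of_zero (mixFF : Fin 4 → (Fin 4 → ℤ) → Fin 4 → (Fin 4 → ℤ) → MKer 4 (Fib 3)) (κ : Fin 4) (u : Fin 4 → ℤ)
    (ρ : Fin 4) (w : Fin 4 → ℤ) : M2Of 3 Lc mixFF 0 κ u ρ w = mixFF κ u ρ w := by
  simp [BalabanStepW2.M2Of, BalabanStepW2.wM2]

/-- [folklore] **THE FINE DIVERGENCE OF `Mmodel` IN ITS FLUCTUATION SLOT, ON FIELD LEGS**: `(cΛ·Lc⁴∕4) · H · (([x + e_β = s] − [x = s]) − ([z + e_β′ = s] − [z = s]))`. -/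
theorem divV_Mmodel_inl_inl (cΛ : ℝ) (ρ' : Fin 4) (w s x z : Fin 4 → ℤ) (β β' : Fin 4) :
    divV (fun κ u => M2Of 3 Lc (Mmodel Lc cΛ) 0 κ u ρ' w) s x z (Sum.inl β) (Sum.inl β') =
      cΛ * (Lc : ℝ) ^ 4 / 4 * hessFFAt (toSite (ctrOff 4 Lc)) Lc ρ' w x z (Sum.inl β) (Sum.inl β') *
        (((if x + unitVec β = s then (1 : ℝ) else 0) - (if x = s then (1 : ℝ) else 0)) -
          ((if z + unitVec β' = s then (1 : ℝ) else 0) - (if z = s then (1 : ℝ) else 0))) := by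
  simp only [KernelWard.divV, Finset.sum_apply, Pi.sub_apply, M2Of_zero, Mmodel_inl_inl, unitVec_eq]
  have ex : ∀ κ : Fin 4, (x = s - unitVec κ ∧ β = κ) ↔ (x + unitVec κ = s ∧ β = κ) := fun κ => by rw [eq_sub_iff_add_eq]
  have ez : ∀ κ : Fin 4, (z = s - unitVec κ ∧ β' = κ) ↔ (z + unitVec κ = s ∧ β' = κ) := fun κ => by rw [eq_sub_iff_add_eq]
  simp only [ex, ez]
  have ha := sum_ite_and_eq (fun κ : Fin 4 => x + unitVec κ = s) β
  have hb := sum_ite_and_eq (fun κ : Fin 4 => z + unitVec κ = s) β'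
  have hc := sum_ite_and_eq (fun _ : Fin 4 => x = s) β
  have hd := sum_ite_and_eq (fun _ : Fin 4 => z = s) β'
  rw [Finset.sum_sub_distrib, ← Finset.mul_sum, ← Finset.mul_sum, Finset.sum_sub_distrib, Finset.sum_sub_distrib, ha, hb, hc, hd]
  ring


/-- [folklore] **THE BLOCK WARD DIVERGENCE OF `Mmodel` ON FIELD LEGS**: with `s_v := Lc•Y + v`,
`((stepScale 0 · Lc⁴)⁻¹ • Σ_v divV (κ u ↦ M2Of 3 Lc Mmodel 0 κ u ρ′ w) s_v) x z β β′ = (cΛ∕4) · H_{ρ′w} x z β β′ · (g_Y(x,β) − g_Y(z,β′))`,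
`g_Y(p,β) = Σ_v [p + e_β = s_v] − Σ_v [p = s_v]`. -/
theorem wardOp_Mmodel_inl_inl (hLc : 1 ≤ Lc) (cΛ : ℝ) (Y : Fin (3 + 1) → ℤ) (ρ' : Fin (3 + 1)) (w x z : Fin (3 + 1) → ℤ) (β β' : Fin (3 + 1)) :
    ((stepScale 3 Lc 0 * (Lc : ℝ) ^ (3 + 1))⁻¹ • ∑ v ∈ box (3 + 1) Lc,
        divV (fun κ u => M2Of 3 Lc (Mmodel Lc cΛ) 0 κ u ρ' w) ((Lc : ℤ) • Y + toSite v)) x z (Sum.inl β) (Sum.inl β') =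
      cΛ / 4 * hessFFAt (toSite (ctrOff 4 Lc)) Lc ρ' w x z (Sum.inl β) (Sum.inl β') *
        (((∑ v ∈ box (3 + 1) Lc, (if x + unitVec β = (Lc : ℤ) • Y + toSite v then (1 : ℝ) else 0)) -
            ∑ v ∈ box (3 + 1) Lc, (if x = (Lc : ℤ) • Y + toSite v then (1 : ℝ) else 0)) -
          ((∑ v ∈ box (3 + 1) Lc, (if z + unitVec β' = (Lc : ℤ) • Y + toSite v then (1 : ℝ) else 0)) -
            ∑ v ∈ box (3 + 1) Lc, (if z = (Lc : ℤ) • Y + toSite v then (1 : ℝ) else 0))) := by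
  have hL : (Lc : ℝ) ≠ 0 := by exact_mod_cast (show Lc ≠ 0 by omega)
  rw [Pi.smul_apply, Pi.smul_apply, Pi.smul_apply, Pi.smul_apply, smul_eq_mul, Finset.sum_apply, Finset.sum_apply,
    Finset.sum_apply, Finset.sum_apply]
  simp only [divV_Mmodel_inl_inl, stepScale_zero, one_mul]
  rw [← Finset.mul_sum, Finset.sum_sub_distrib, Finset.sum_sub_distrib, Finset.sum_sub_distrib]
  have h4 : (Lc : ℝ) ^ (3 + 1) = (Lc : ℝ) ^ 4 := by norm_num
  rw [h4]
  field_simp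

omit [NeZero Lc] in
/-- [folklore] **THE MIXED DATUM ON FIELD LEGS**: `[M1At 0 ρ′ w, D_Y] x z β β′ = cΛ · H_{ρ′w} x z β β′ · (½ Σ_v [z = s_v] − ½ Σ_v [x = s_v])` (`wM1 0 = 1`). -/
theorem mixedDatum_inl_inl (cΛ : ℝ) (Y : Fin (3 + 1) → ℤ) (ρ' : Fin (3 + 1)) (w x z : Fin (3 + 1) → ℤ) (β β' : Fin (3 + 1)) :
    (comp (M1At 3 Lc (toSite (ctrOff (3 + 1) Lc)) cΛ 0 ρ' w)
        (diagK (((1 : ℝ) / 2) • ∑ v ∈ box (3 + 1) Lc, legInd (toSite (ctrOff (3 + 1) Lc)) ((Lc : ℤ) • Y + toSite v))) -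
      comp (diagK (((1 : ℝ) / 2) • ∑ v ∈ box (3 + 1) Lc, legInd (toSite (ctrOff (3 + 1) Lc)) ((Lc : ℤ) • Y + toSite v)))
        (M1At 3 Lc (toSite (ctrOff (3 + 1) Lc)) cΛ 0 ρ' w)) x z (Sum.inl β) (Sum.inl β') =
      cΛ * hessFFAt (toSite (ctrOff 4 Lc)) Lc ρ' w x z (Sum.inl β) (Sum.inl β') *
        ((1 / 2) * (∑ v ∈ box (3 + 1) Lc, (if z = (Lc : ℤ) • Y + toSite v then (1 : ℝ) else 0)) -
          (1 / 2) * ∑ v ∈ box (3 + 1) Lc, (if x = (Lc : ℤ) • Y + toSite v then (1 : ℝ) else 0)) := by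
  change conjV _ (diagK _) x z _ _ = _
  rw [conjV_diagK_apply]
  simp only [SpineRooted.M1At, Pi.smul_apply, Finset.sum_apply, smul_eq_mul, legInd_inl, BalabanStepW2.wM1, pow_zero, one_pow,
    mul_one]

/-! ## §3 Parity: an odd residual cannot absorb the (even) mismatch -/

/-- [folklore] **(W-M₀) FOR `Mmodel` WITH A PARITY-ODD RESIDUAL FORCES THE FF MISMATCH TO VANISH**: `cΛ · H_{ρ′w} x z β β′ · (E_Y(x,β) − E_Y(z,β′)) = 0`,
`E_Y(p,β) = Σ_v [p = s_v] + Σ_v [p + e_β = s_v]` (the residual on ff legs is `(cΛ∕4)·H·(E − E′)`; transposed, by `hessFFAt_antisymm`, it is its own negative). -/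
theorem mismatch_eq_zero_of_parity (hLc : 1 ≤ Lc) (cΛ : ℝ)
    {RM₀ : (Fin (3 + 1) → ℤ) → Fin (3 + 1) → (Fin (3 + 1) → ℤ) → MKer (3 + 1) (Fib 3)}
    (hRM₀p : ∀ y ρ' w, trK (RM₀ y ρ' w) = -sgnK (RM₀ y ρ' w))
    (hM : ∀ (y : Fin (3 + 1) → ℤ) (ρ' : Fin (3 + 1)) (w : Fin (3 + 1) → ℤ),
      (stepScale 3 Lc 0 * (Lc : ℝ) ^ (3 + 1))⁻¹ • ∑ v ∈ box (3 + 1) Lc,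
          divV (fun κ u => M2Of 3 Lc (Mmodel Lc cΛ) 0 κ u ρ' w) ((Lc : ℤ) • y + toSite v) =
        comp (M1At 3 Lc (toSite (ctrOff (3 + 1) Lc)) cΛ 0 ρ' w)
            (diagK (((1 : ℝ) / 2) • ∑ v ∈ box (3 + 1) Lc, legInd (toSite (ctrOff (3 + 1) Lc)) ((Lc : ℤ) • y + toSite v))) -
          comp (diagK (((1 : ℝ) / 2) • ∑ v ∈ box (3 + 1) Lc, legInd (toSite (ctrOff (3 + 1) Lc)) ((Lc : ℤ) • y + toSite v)))
            (M1At 3 Lc (toSite (ctrOff (3 + 1) Lc)) cΛ 0 ρ' w) +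
          RM₀ y ρ' w)
    (Y : Fin (3 + 1) → ℤ) (ρ' : Fin (3 + 1)) (w x z : Fin (3 + 1) → ℤ) (β β' : Fin (3 + 1)) :
    cΛ * hessFFAt (toSite (ctrOff 4 Lc)) Lc ρ' w x z (Sum.inl β) (Sum.inl β') *
      (((∑ v ∈ box (3 + 1) Lc, (if x = (Lc : ℤ) • Y + toSite v then (1 : ℝ) else 0)) +
          ∑ v ∈ box (3 + 1) Lc, (if x + unitVec β = (Lc : ℤ) • Y + toSite v then (1 : ℝ) else 0)) -
        ((∑ v ∈ box (3 + 1) Lc, (if z = (Lc : ℤ) • Y + toSite v then (1 : ℝ) else 0)) +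
          ∑ v ∈ box (3 + 1) Lc, (if z + unitVec β' = (Lc : ℤ) • Y + toSite v then (1 : ℝ) else 0))) = 0 := by
  -- the residual entry on field legs, at `(x, z, β, β′)` and at the transposed position
  have hR : ∀ (x z : Fin (3 + 1) → ℤ) (β β' : Fin (3 + 1)), RM₀ Y ρ' w x z (Sum.inl β) (Sum.inl β') =
      cΛ / 4 * hessFFAt (toSite (ctrOff 4 Lc)) Lc ρ' w x z (Sum.inl β) (Sum.inl β') *
        (((∑ v ∈ box (3 + 1) Lc, (if x = (Lc : ℤ) • Y + toSite v then (1 : ℝ) else 0)) +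
            ∑ v ∈ box (3 + 1) Lc, (if x + unitVec β = (Lc : ℤ) • Y + toSite v then (1 : ℝ) else 0)) -
          ((∑ v ∈ box (3 + 1) Lc, (if z = (Lc : ℤ) • Y + toSite v then (1 : ℝ) else 0)) +
            ∑ v ∈ box (3 + 1) Lc, (if z + unitVec β' = (Lc : ℤ) • Y + toSite v then (1 : ℝ) else 0))) := by
    intro x z β β'
    have e := congrFun (congrFun (congrFun (congrFun (hM Y ρ' w) x) z) (Sum.inl β)) (Sum.inl β')
    rw [Pi.add_apply, Pi.add_apply, Pi.add_apply, Pi.add_apply, wardOp_Mmodel_inl_inl hLc, mixedDatum_inl_inl] at e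
    linear_combination -e
  have hT := congrFun (congrFun (congrFun (congrFun (hRM₀p Y ρ' w) x) z) (Sum.inl β)) (Sum.inl β')
  rw [trK_apply, Pi.neg_apply, Pi.neg_apply, Pi.neg_apply, Pi.neg_apply, sgnK_apply, hR, hR,
    hessFFAt_antisymm (toSite (ctrOff 4 Lc)) Lc ρ' w x z (Sum.inl β) (Sum.inl β')] at hT
  simp only [BorderedHessian.sgnF_inl, one_mul] at hT
  linear_combination (2 : ℝ) * hT

/-- [folklore] **THE SAME FROM THE EVEN-HALF FORM OF (W-M₀)** (`WardLocusParitySplit` ∕ `…_of_evenHalf_laws₀`'s `hEM0` for `mixFF := Mmodel`):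
`L + sgnK (trK L) = 2 • [M1At 0, D_Y]` forces the same ff identity (on field legs `sgnK (trK L) = L` by `hessFFAt_antisymm`). -/
theorem mismatch_eq_zero_of_evenHalf (hLc : 1 ≤ Lc) (cΛ : ℝ)
    (hEM : ∀ (y : Fin (3 + 1) → ℤ) (ρ' : Fin (3 + 1)) (w : Fin (3 + 1) → ℤ),
      (stepScale 3 Lc 0 * (Lc : ℝ) ^ (3 + 1))⁻¹ • ∑ v ∈ box (3 + 1) Lc,
            divV (fun κ u => M2Of 3 Lc (Mmodel Lc cΛ) 0 κ u ρ' w) ((Lc : ℤ) • y + toSite v)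
          + sgnK (trK ((stepScale 3 Lc 0 * (Lc : ℝ) ^ (3 + 1))⁻¹ • ∑ v ∈ box (3 + 1) Lc,
            divV (fun κ u => M2Of 3 Lc (Mmodel Lc cΛ) 0 κ u ρ' w) ((Lc : ℤ) • y + toSite v))) =
        (2 : ℝ) • (comp (M1At 3 Lc (toSite (ctrOff (3 + 1) Lc)) cΛ 0 ρ' w)
            (diagK (((1 : ℝ) / 2) • ∑ v ∈ box (3 + 1) Lc, legInd (toSite (ctrOff (3 + 1) Lc)) ((Lc : ℤ) • y + toSite v))) -
          comp (diagK (((1 : ℝ) / 2) • ∑ v ∈ box (3 + 1) Lc, legInd (toSite (ctrOff (3 + 1) Lc)) ((Lc : ℤ) • y + toSite v)))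
            (M1At 3 Lc (toSite (ctrOff (3 + 1) Lc)) cΛ 0 ρ' w)))
    (Y : Fin (3 + 1) → ℤ) (ρ' : Fin (3 + 1)) (w x z : Fin (3 + 1) → ℤ) (β β' : Fin (3 + 1)) :
    cΛ * hessFFAt (toSite (ctrOff 4 Lc)) Lc ρ' w x z (Sum.inl β) (Sum.inl β') *
      (((∑ v ∈ box (3 + 1) Lc, (if x = (Lc : ℤ) • Y + toSite v then (1 : ℝ) else 0)) +
          ∑ v ∈ box (3 + 1) Lc, (if x + unitVec β = (Lc : ℤ) • Y + toSite v then (1 : ℝ) else 0)) -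
        ((∑ v ∈ box (3 + 1) Lc, (if z = (Lc : ℤ) • Y + toSite v then (1 : ℝ) else 0)) +
          ∑ v ∈ box (3 + 1) Lc, (if z + unitVec β' = (Lc : ℤ) • Y + toSite v then (1 : ℝ) else 0))) = 0 := by
  have e := congrFun (congrFun (congrFun (congrFun (hEM Y ρ' w) x) z) (Sum.inl β)) (Sum.inl β')
  rw [Pi.add_apply, Pi.add_apply, Pi.add_apply, Pi.add_apply, sgnK_apply, trK_apply, wardOp_Mmodel_inl_inl hLc,
    wardOp_Mmodel_inl_inl hLc, Pi.smul_apply, Pi.smul_apply, Pi.smul_apply, Pi.smul_apply, smul_eq_mul, mixedDatum_inl_inl,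
    hessFFAt_antisymm (toSite (ctrOff 4 Lc)) Lc ρ' w x z (Sum.inl β) (Sum.inl β')] at e
  simp only [BorderedHessian.sgnF_inl, one_mul] at e
  linear_combination (2 : ℝ) * e

/-! ## §4 A discrete divergence theorem on a finite site set -/
/-- [folklore] **DISCRETE DIVERGENCE THEOREM**: if `h κ x ≠ 0` only when both endpoints `x`, `x + e_κ` lie in the finite site set `S`, then
`Σ_{z∈S} Σ_κ (h κ (z − e_κ) − h κ z) = 0` (each internal bond enters once with each sign). -/
theorem sum_div_eq_zero_of_internal {D : ℕ} (S : Finset (Fin D → ℤ)) (h : Fin D → (Fin D → ℤ) → ℝ)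
    (hsupp : ∀ κ x, h κ x ≠ 0 → x ∈ S ∧ x + unitVec κ ∈ S) :
    ∑ z ∈ S, ∑ κ : Fin D, (h κ (z - unitVec κ) - h κ z) = 0 := by
  classical
  rw [Finset.sum_comm]
  refine Finset.sum_eq_zero fun κ _ => ?_
  rw [Finset.sum_sub_distrib, sub_eq_zero]
  -- two finite sets carrying the support of `h κ` have the same sum
  have key : ∀ A B : Finset (Fin D → ℤ), (∀ x, h κ x ≠ 0 → x ∈ A ∧ x ∈ B) → ∑ x ∈ A, h κ x = ∑ x ∈ B, h κ x := by
    intro A B hAB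
    have hA : ∑ x ∈ A, h κ x = ∑ x ∈ A ∪ B, h κ x :=
      Finset.sum_subset Finset.subset_union_left fun x _ hx => by
        by_contra hne; exact hx (hAB x hne).1
    have hB : ∑ x ∈ B, h κ x = ∑ x ∈ A ∪ B, h κ x :=
      Finset.sum_subset Finset.subset_union_right fun x _ hx => by
        by_contra hne; exact hx (hAB x hne).2
    rw [hA, hB]
  have hinj : Set.InjOn (fun z : Fin D → ℤ => z - unitVec κ) ↑S := fun a _ b _ hab => sub_left_injective hab
  rw [← Finset.sum_image (f := h κ) hinj]
  refine key _ _ fun x hx => ⟨?_, (hsupp κ x hx).1⟩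
  exact Finset.mem_image.2 ⟨x + unitVec κ, (hsupp κ x hx).2, add_sub_cancel_right x _⟩

/-! ## §5 The witness: the root bond `f′ = (3, ρ_c)` of the block `B(0)` -/
omit [NeZero Lc] in
/-- [folklore] The indicator sum of a box point: `Σ_{v ∈ box} [toSite v₀ = toSite v] = 1` (`v₀ ∈ box`; `toSite` is injective). -/
theorem sum_box_indicator_eq_one {v₀ : Fin (3 + 1) → ℕ} (hv₀ : v₀ ∈ box (3 + 1) Lc) :
    ∑ v ∈ box (3 + 1) Lc, (if toSite v₀ = toSite v then (1 : ℝ) else 0) = 1 := by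
  rw [Finset.sum_eq_single v₀ (fun v _ hv => if_neg fun e => hv (AxialProjector.toSite_injective e).symm)
    (fun h => absurd hv₀ h), if_pos rfl]

omit [NeZero Lc] in
/-- [folklore] An indicator sum over the box is at most `1`. -/
theorem sum_box_indicator_le_one (a : Fin (3 + 1) → ℤ) :
    ∑ v ∈ box (3 + 1) Lc, (if a = toSite v then (1 : ℝ) else 0) ≤ 1 := by
  classical
  have h1 : ((box (3 + 1) Lc).filter (fun v => a = toSite v)).card ≤ 1 := Finset.card_le_one.2 fun v hv v' hv' =>
    AxialProjector.toSite_injective (((Finset.mem_filter.1 hv).2).symm.trans (Finset.mem_filter.1 hv').2)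
  rw [Finset.sum_boole]; exact_mod_cast h1

omit [NeZero Lc] in
/-- [folklore] A non-zero indicator sum over the box certifies membership in the block `toSite '' box`. -/
theorem mem_image_of_sum_box_indicator_ne_zero {a : Fin (3 + 1) → ℤ}
    (h : ∑ v ∈ box (3 + 1) Lc, (if a = toSite v then (1 : ℝ) else 0) ≠ 0) : a ∈ (box (3 + 1) Lc).image toSite := by
  classical
  obtain ⟨v, hv, hne⟩ := Finset.exists_ne_zero_of_sum_ne_zero h
  have hav : a = toSite v := by by_contra hav; exact hne (if_neg hav)
  exact Finset.mem_image.2 ⟨v, hv, hav.symm⟩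

omit [NeZero Lc] in
/-- [folklore] The centred root shifted by `e_3` is a box point for `2 ≤ Lc`: `ρ_c + e_3 = toSite v₊` with `v₊ ∈ box`. -/
theorem ctr_add_unitVec_three (hLc : 2 ≤ Lc) :
    toSite (ctrOff 4 Lc) + unitVec (3 : Fin (3 + 1)) = toSite (fun i : Fin (3 + 1) => if i = 3 then (Lc - 1) / 2 + 1 else (Lc - 1) / 2) ∧
      (fun i : Fin (3 + 1) => if i = 3 then (Lc - 1) / 2 + 1 else (Lc - 1) / 2) ∈ box (3 + 1) Lc := by
  constructor
  · funext i
    simp only [Pi.add_apply, AffineAveraging.toSite, AveragingContoursRooted.ctrOff, unitVec_apply]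
    by_cases hi : i = 3
    · rw [if_pos hi, if_pos hi]; push_cast; ring
    · rw [if_neg hi, if_neg hi]; ring
  · refine Fintype.mem_piFinset.2 fun i => Finset.mem_range.2 ?_
    split_ifs <;> omega

omit [NeZero Lc] in
/-- [folklore] `ρ_c + Lc•e_0` lies in NO point of the block `B(0)` (its `0`-coordinate is `≥ Lc`). -/
theorem sum_box_indicator_ctr_add_smul :
    ∑ v ∈ box (3 + 1) Lc, (if toSite (ctrOff 4 Lc) + (Lc : ℤ) • unitVec (0 : Fin (3 + 1)) = toSite v then (1 : ℝ) else 0) = 0 := by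
  refine Finset.sum_eq_zero fun v hv => if_neg fun e => ?_
  have e0 := congrFun e 0
  simp only [Pi.add_apply, Pi.smul_apply, AffineAveraging.toSite, AveragingContoursRooted.ctrOff, unitVec_apply, if_true,
    smul_eq_mul, mul_one] at e0
  have hv0 : v 0 < Lc := Finset.mem_range.1 (Fintype.mem_piFinset.1 hv 0)
  omega

omit [NeZero Lc] in
/-- [folklore] **THE FF MISMATCH DOES NOT VANISH** (`2 ≤ Lc`, `cΛ ≠ 0`): were `b ↦ H_{0,0}(b, f′)`, `f′ = (3, ρ_c)` (both endpoints in `B(0)`), non-zero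
only on bonds internal to `B(0)`, its divergence summed over `B(0)` would vanish (§4); but `hessKerAt_div_left` summed over `B(0)` gives
`([ρ_c ∈ B] + [ρ_c + e_3 ∈ B] − [ρ_c ∈ B] − [ρ_c + Lc•e_0 ∈ B])·q¹(f′)∕2 = q¹(f′)∕2 ≠ 0` (`linCountAt_ctr_pos`). -/
theorem not_key (hLc : 2 ≤ Lc) {cΛ : ℝ} (hcΛ : cΛ ≠ 0)
    (hkey : ∀ (x z : Fin (3 + 1) → ℤ) (β β' : Fin (3 + 1)),
      cΛ * hessFFAt (toSite (ctrOff 4 Lc)) Lc 0 0 x z (Sum.inl β) (Sum.inl β') *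
        (((∑ v ∈ box (3 + 1) Lc, (if x = toSite v then (1 : ℝ) else 0)) +
            ∑ v ∈ box (3 + 1) Lc, (if x + unitVec β = toSite v then (1 : ℝ) else 0)) -
          ((∑ v ∈ box (3 + 1) Lc, (if z = toSite v then (1 : ℝ) else 0)) +
            ∑ v ∈ box (3 + 1) Lc, (if z + unitVec β' = toSite v then (1 : ℝ) else 0))) = 0) : False := by
  classical
  have hL1 : 1 ≤ Lc := by omega
  obtain ⟨hplus, hmem⟩ := ctr_add_unitVec_three hLc
  -- the indicator sums at the root bond
  have hI : ∑ v ∈ box (3 + 1) Lc, (if toSite (ctrOff 4 Lc) = toSite v then (1 : ℝ) else 0) = 1 :=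
    sum_box_indicator_eq_one (ctrOff_mem_box hL1)
  have hA : ∑ v ∈ box (3 + 1) Lc, (if toSite (ctrOff 4 Lc) + unitVec (3 : Fin (3 + 1)) = toSite v then (1 : ℝ) else 0) = 1 := by
    rw [hplus]; exact sum_box_indicator_eq_one hmem
  have hZ := sum_box_indicator_ctr_add_smul (Lc := Lc)
  -- the first-order kernel at the root bond is non-zero
  have hq : linKerAt (toSite (ctrOff 4 Lc)) Lc 0 0 (3, toSite (ctrOff 4 Lc)) ≠ 0 := by
    have hpos := (linCountAt_ctr_pos (e := 1) (τ := 3) (σ := 2) (μ := 0) hLc rfl rfl (by decide) (by decide)).1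
    exact div_ne_zero (by exact_mod_cast hpos.ne') (pow_ne_zero _ (by exact_mod_cast (show Lc ≠ 0 by omega)))
  -- the bond function `b ↦ H(b, f′)` and its support
  set h : Fin (3 + 1) → (Fin (3 + 1) → ℤ) → ℝ := fun κ x => hessKerAt (toSite (ctrOff 4 Lc)) Lc 0 0 (κ, x) (3, toSite (ctrOff 4 Lc))
    with hh
  have hsupp : ∀ κ x, h κ x ≠ 0 → x ∈ (box (3 + 1) Lc).image toSite ∧ x + unitVec κ ∈ (box (3 + 1) Lc).image toSite := by
    intro κ x hx
    have e := hkey x (toSite (ctrOff 4 Lc)) κ 3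
    rw [hessFFAt_inl_inl, hI, hA] at e
    have e2 : (∑ v ∈ box (3 + 1) Lc, (if x = toSite v then (1 : ℝ) else 0)) +
        ∑ v ∈ box (3 + 1) Lc, (if x + unitVec κ = toSite v then (1 : ℝ) else 0) = 2 := by
      rcases mul_eq_zero.1 e with h1 | h2
      · exact absurd h1 (mul_ne_zero hcΛ hx)
      · linarith
    have l1 := sum_box_indicator_le_one (Lc := Lc) x
    have l2 := sum_box_indicator_le_one (Lc := Lc) (x + unitVec κ)
    exact ⟨mem_image_of_sum_box_indicator_ne_zero (by linarith), mem_image_of_sum_box_indicator_ne_zero (by linarith)⟩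
  -- the divergence summed over the block: zero by §4 …
  have h0 := sum_div_eq_zero_of_internal ((box (3 + 1) Lc).image toSite) h hsupp
  rw [Finset.sum_image AxialProjector.toSite_injective.injOn] at h0
  -- … and `q¹(f′)/2` by the rooted Ward identity
  have hW : ∑ v ∈ box (3 + 1) Lc, ∑ κ : Fin (3 + 1), (h κ (toSite v - unitVec κ) - h κ (toSite v)) =
      linKerAt (toSite (ctrOff 4 Lc)) Lc 0 0 (3, toSite (ctrOff 4 Lc)) / 2 := by
    simp only [hh]
    rw [Finset.sum_congr rfl fun v _ => hessKerAt_div_left hL1 (toSite (ctrOff 4 Lc)) 0 0 (toSite v) (3, toSite (ctrOff 4 Lc))]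
    simp only [smul_zero, zero_add]
    rw [← Finset.sum_div, ← Finset.sum_mul, Finset.sum_sub_distrib, Finset.sum_sub_distrib, Finset.sum_add_distrib, hI, hA, hZ]
    ring
  rw [hW] at h0
  exact hq (by linarith)

/-! ## §6 The no-go in both currencies -/
/-- [folklore] **NO-GO (exact ∕ residual currency)**: for `2 ≤ Lc`, `cΛ ≠ 0`, there is NO row-parity-odd residual `RM₀` with which the owner's model mixed
table `Mmodel` (K-M1) satisfies the hW level-0 mixed Ward letter (W-M₀) of `WardLocusParityLevels.…_TW_su_exact₀` (hypothesis `hM₂0` at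
`mixFF := Mmodel Lc cΛ`, `r := ctrOff 4 Lc`).  The K-M2 model literal is hR-only. -/
theorem not_wardMixed_Mmodel (hLc : 2 ≤ Lc) {cΛ : ℝ} (hcΛ : cΛ ≠ 0)
    {RM₀ : (Fin (3 + 1) → ℤ) → Fin (3 + 1) → (Fin (3 + 1) → ℤ) → MKer (3 + 1) (Fib 3)}
    (hRM₀p : ∀ y ρ' w, trK (RM₀ y ρ' w) = -sgnK (RM₀ y ρ' w)) :
    ¬ (∀ (y : Fin (3 + 1) → ℤ) (ρ' : Fin (3 + 1)) (w : Fin (3 + 1) → ℤ),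
      (stepScale 3 Lc 0 * (Lc : ℝ) ^ (3 + 1))⁻¹ • ∑ v ∈ box (3 + 1) Lc,
          divV (fun κ u => M2Of 3 Lc (Mmodel Lc cΛ) 0 κ u ρ' w) ((Lc : ℤ) • y + toSite v) =
        comp (M1At 3 Lc (toSite (ctrOff (3 + 1) Lc)) cΛ 0 ρ' w)
            (diagK (((1 : ℝ) / 2) • ∑ v ∈ box (3 + 1) Lc, legInd (toSite (ctrOff (3 + 1) Lc)) ((Lc : ℤ) • y + toSite v))) -
          comp (diagK (((1 : ℝ) / 2) • ∑ v ∈ box (3 + 1) Lc, legInd (toSite (ctrOff (3 + 1) Lc)) ((Lc : ℤ) • y + toSite v)))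
            (M1At 3 Lc (toSite (ctrOff (3 + 1) Lc)) cΛ 0 ρ' w) +
          RM₀ y ρ' w) := by
  intro hM
  refine not_key hLc hcΛ fun x z β β' => ?_
  simpa only [smul_zero, zero_add] using mismatch_eq_zero_of_parity (by omega) cΛ hRM₀p hM 0 0 0 x z β β'

/-- [folklore] **NO-GO (even-half currency)**: for `2 ≤ Lc`, `cΛ ≠ 0`, the model mixed table `Mmodel` violates the even-half form of (W-M₀)
(`WardLocusParityLevels.…_of_evenHalf_laws₀`'s `hEM0` at `mixFF := Mmodel Lc cΛ`, `r := ctrOff 4 Lc`). -/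
theorem not_wardMixedEven_Mmodel (hLc : 2 ≤ Lc) {cΛ : ℝ} (hcΛ : cΛ ≠ 0) :
    ¬ (∀ (y : Fin (3 + 1) → ℤ) (ρ' : Fin (3 + 1)) (w : Fin (3 + 1) → ℤ),
      (stepScale 3 Lc 0 * (Lc : ℝ) ^ (3 + 1))⁻¹ • ∑ v ∈ box (3 + 1) Lc,
            divV (fun κ u => M2Of 3 Lc (Mmodel Lc cΛ) 0 κ u ρ' w) ((Lc : ℤ) • y + toSite v)
          + sgnK (trK ((stepScale 3 Lc 0 * (Lc : ℝ) ^ (3 + 1))⁻¹ • ∑ v ∈ box (3 + 1) Lc,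
            divV (fun κ u => M2Of 3 Lc (Mmodel Lc cΛ) 0 κ u ρ' w) ((Lc : ℤ) • y + toSite v))) =
        (2 : ℝ) • (comp (M1At 3 Lc (toSite (ctrOff (3 + 1) Lc)) cΛ 0 ρ' w)
            (diagK (((1 : ℝ) / 2) • ∑ v ∈ box (3 + 1) Lc, legInd (toSite (ctrOff (3 + 1) Lc)) ((Lc : ℤ) • y + toSite v))) -
          comp (diagK (((1 : ℝ) / 2) • ∑ v ∈ box (3 + 1) Lc, legInd (toSite (ctrOff (3 + 1) Lc)) ((Lc : ℤ) • y + toSite v)))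
            (M1At 3 Lc (toSite (ctrOff (3 + 1) Lc)) cΛ 0 ρ' w))) := by
  intro hEM
  refine not_key hLc hcΛ fun x z β β' => ?_
  simpa only [smul_zero, zero_add] using mismatch_eq_zero_of_evenHalf (by omega) cΛ hEM 0 0 0 x z β β'

end Summit.QuantumFields.BalabanUV.Beta.WardMixedModelNoGo

end
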